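import Literature.Analysis.FluidPDE.OnsagerBDSVThreeStagesProofs
import Literature.Analysis.FluidPDE.OnsagerBDSVMollificationProofs
import Literature.Analysis.FluidPDE.OnsagerBDSVGluingProofs
import Literature.Analysis.FluidPDE.OnsagerBDSVLocalEulerProofs
import Literature.Analysis.FluidPDE.EulerTorusLocalExistenceProofs
import Literature.Analysis.FluidPDE.OnsagerBDSVPerturbationAssembly
import Literature.Analysis.FluidPDE.OnsagerBDSVEnergyEstimateHolds
import Literature.Analysis.FluidPDE.OnsagerBDSVIncrementEstimateProofs
import HarnessLib

/-!
# BDSV Prop. 2.1 (`BDSV.mainIteration`): reduction to the four remaining named facts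

Buckmaster–De Lellis–Székelyhidi–Vicol (BDSV), *Onsager's conjecture for admissible weak
solutions*, Comm. Pure Appl. Math. **72** (2019) 229–274 = arXiv:1701.08678, Prop. 2.1 (the
main iterative proposition, `BDSV.mainIteration` of `OnsagerBDSV.lean`). Its proof in the tree is
organised along the three stages of §2.3 (`BDSV.mainIteration_of_threeStages`,
`OnsagerBDSVThreeStagesProofs.lean`: mollification §2.4, gluing §2.5/§§3–4, perturbation
§2.6/§§5–6). This file joins everything proved so far into ONE reduction, so that the current
frontier of the discharge of Prop. 2.1 is a single statement with exactly the outstanding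
published inputs as hypotheses (`BDSV.mainIteration_of_remaining`):

* the mollification stage (Prop. 2.2) is proved: `BDSV.mollificationStage_holds`
  (`OnsagerBDSVMollificationProofs.lean`);
* the gluing stage (§2.5) follows (`BDSV.gluingStage_of_localEuler_of_stability_of_glued`,
  `OnsagerBDSVGluingProofs.lean`) from Prop. 3.1 (`BDSV.localEulerHolder`), §3
  (`BDSV.gluingStability`: Cor. 3.2, Props. 3.3–3.4) and §4 (`BDSV.gluedTripleEstimates`:
  Props. 4.1–4.4); and Prop. 3.1 follows (`BDSV.localEulerHolder_of_shortTime_of_propagation`,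
  `OnsagerBDSVLocalEulerProofs.lean`) from short-time existence of smooth Euler solutions
  (`Torus.eulerSmoothShortTime`, Majda–Bertozzi Thm. 3.4) and the PROVED propagation of Hölder
  bounds (`Torus.eulerHolderPropagation_holds`, `EulerTorusLocalExistenceProofs.lean`) — whence
  `BDSV.localEulerHolder_of_shortTime` below;
* the perturbation stage (§2.6) follows (`BDSV.perturbationStage_of_three`,
  `OnsagerBDSVPerturbationAssembly.lean`) from Cor. 5.8 (5.31), Prop. 6.1 and Prop. 6.2, of which
  Cor. 5.8 (`BDSV.incrementEstimate_holds`, `OnsagerBDSVIncrementEstimateProofs.lean`) and Prop. 6.2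
  (`BDSV.energyEstimate_holds`, `OnsagerBDSVEnergyEstimateHolds.lean`) are proved — whence
  `BDSV.perturbationStage_of_stressEstimate` below.

Hence `BDSV.mainIteration` (and the intermediate `BDSV.stagesEstimate` of
`OnsagerBDSVStages.lean`) follow from the four named facts `Torus.eulerSmoothShortTime`
(Majda–Bertozzi 2002, Thm. 3.4), `BDSV.gluingStability` (BDSV §3), `BDSV.gluedTripleEstimates`
(BDSV §4) and `BDSV.stressEstimate` (BDSV Prop. 6.1). When these are discharged,
`theorem mainIteration_holds : mainIteration := mainIteration_of_remaining
Torus.eulerSmoothShortTime_holds gluingStability_holds gluedTripleEstimates_holds stressEstimate_holds`.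
The file also certifies that the import closures of all the proof files involved are compatible.

## References

* T. Buckmaster, C. De Lellis, L. Székelyhidi Jr., V. Vicol, *Onsager's conjecture for admissible
  weak solutions*, Comm. Pure Appl. Math. 72 (2019) 229–274 = arXiv:1701.08678: Prop. 2.1 and
  §2.3–2.6 (the three stages, "Proof of Proposition 2.1"); Prop. 2.2; Prop. 3.1, Cor. 3.2,
  Props. 3.3–3.4; Props. 4.1–4.4; Cor. 5.8; Props. 6.1–6.2.
* A. J. Majda, A. L. Bertozzi, *Vorticity and incompressible flow*, CUP 2002, Thm. 3.4.
-/

namespace Literature.Analysis.FluidPDE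

namespace BDSV

/-- **Prop. 3.1 from short-time existence alone**: the reduction
`BDSV.localEulerHolder_of_shortTime_of_propagation` fed with the proved propagation of Hölder
bounds `Torus.eulerHolderPropagation_holds` (BDSV, proof of Prop. 3.1: pressure equation,
Schauder, (B.2) and Grönwall). [cite: BuckmasterEtAl2018, Prop. 3.1] -/
theorem localEulerHolder_of_shortTime (h : Torus.eulerSmoothShortTime) : localEulerHolder :=
  localEulerHolder_of_shortTime_of_propagation h Torus.eulerHolderPropagation_holds

/-- **The gluing stage from its three open inputs** (§2.5 from Majda–Bertozzi Thm. 3.4, BDSV §3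
and BDSV §4). [cite: BuckmasterEtAl2018, §2.5 and §3.1] -/
theorem gluingStage_of_shortTime_of_stability_of_glued (h₁ : Torus.eulerSmoothShortTime)
    (h₂ : gluingStability) (h₃ : gluedTripleEstimates) : gluingStage :=
  gluingStage_of_localEuler_of_stability_of_glued (localEulerHolder_of_shortTime h₁) h₂ h₃

/-- **The perturbation stage from Prop. 6.1 alone** (§2.6: "(2.23)–(2.24c), cf. Corollary 5.8
and Propositions 6.1 and 6.2", with Cor. 5.8 (5.31) and Prop. 6.2 proved in the tree).
[cite: BuckmasterEtAl2018, §2.6 (2.23)–(2.24c)] -/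
theorem perturbationStage_of_stressEstimate (h : stressEstimate) : perturbationStage :=
  perturbationStage_of_three incrementEstimate_holds h energyEstimate_holds

/-- **The stages estimate from the four remaining facts** (the intermediate named fact
`BDSV.stagesEstimate` of `OnsagerBDSVStages.lean`, via `BDSV.stagesEstimate_of_threeStages`).
[cite: BuckmasterEtAl2018, §2.3–2.6] -/
theorem stagesEstimate_of_remaining (h₁ : Torus.eulerSmoothShortTime) (h₂ : gluingStability)
    (h₃ : gluedTripleEstimates) (h₄ : stressEstimate) : stagesEstimate :=
  stagesEstimate_of_threeStages mollificationStage_holds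
    (gluingStage_of_shortTime_of_stability_of_glued h₁ h₂ h₃) (perturbationStage_of_stressEstimate h₄)

/-- **BDSV Prop. 2.1 from the four remaining facts**: the main iterative proposition
`BDSV.mainIteration` follows from short-time existence of smooth Euler solutions on `T³`
(`Torus.eulerSmoothShortTime`, Majda–Bertozzi Thm. 3.4), the stability estimates of §3
(`BDSV.gluingStability`), the glued-triple estimates of §4 (`BDSV.gluedTripleEstimates`) and the
Reynolds stress estimate Prop. 6.1 (`BDSV.stressEstimate`) — everything else in the printed
proof of Prop. 2.1 (Prop. 2.2; the propagation half of Prop. 3.1; the assembly of §§2.5–2.6 with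
the parameter inequalities (2.25)–(2.26); Lemma 5.1, Lemma 5.3, §5.2, §5.4, Cor. 5.8, Prop. 6.2)
being proved in the tree. [cite: BuckmasterEtAl2018, Prop. 2.1 (proof, §2.6)] -/
theorem mainIteration_of_remaining (h₁ : Torus.eulerSmoothShortTime) (h₂ : gluingStability)
    (h₃ : gluedTripleEstimates) (h₄ : stressEstimate) : mainIteration :=
  mainIteration_of_threeStages mollificationStage_holds
    (gluingStage_of_shortTime_of_stability_of_glued h₁ h₂ h₃) (perturbationStage_of_stressEstimate h₄)

end BDSV

end Literature.Analysis.FluidPDE
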